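import Literature.Topology.FourManifolds.TrisectionsSectorTwoDecomposition
import Literature.Topology.FourManifolds.MorseExtrema
import HarnessLib

/-!
# The three sectors of the Morse-theoretic trisection are connected

Topic `Literature/Topology/FourManifolds`; step F (part iii) of a Morse-theoretic construction
of Gay–Kirby's trisection for the fact seat
`provefact-Literature.Topology.FourManifolds.exists_isBalancedGKTrisection` (Gay–Kirby 2016,
Thm. 4 via §4, Lemma 14).  Everything in this file is **proved**; no definitions.

For the sectors `X₁ = {s ≤ 0, 2s ≤ T}`, `X₂ = {0 ≤ s ≤ T}`, `X₃ = {T ≤ 2s, T ≤ s}` of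
`TrisectionsTwoFunctionAtlas.lean` with `T = T_bot` (`TrisectionsTopHeightBot.lean`) we prove
(pre)connectedness by a minimum argument (`isPreconnected_of_core`): on a piece `K` of a
clopen decomposition of the sector, the height `f` attains its minimum (for `X₃`: maximum) at
a point `p`; if `p` is interior to the sector it is a local extremum of `f` on `X`, hence the
minimum `m₀` of `f` (resp. the maximum, resp. — for `X₂` — impossible, the critical points of
the band not being local minima); if `p` lies on a face, the gradient-like flow moves `p` into
the sector while decreasing (increasing) `f` — the derivatives along the flow of `s`, `T - s`,
`2s - T`, `T - 2s` have the signs `+`, `-`, `+`, `-` on the band (`D ≤ 0`,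
`HandleBoxes.mlineDeriv_topHeightBot_eq`) — contradicting extremality.  So every piece contains
the core (`{m₀}`, the level `Y ∩ X₂`, `{M₀}`), and the sector is preconnected as soon as the
core is (`isPreconnected_S₁`, `isPreconnected_S₂`, `isPreconnected_S₃`).

## References

* D. Gay, R. Kirby, *Trisecting 4-manifolds*, Geom. Topol. 20 (2016), §4, Lemma 14. [GayKirby2016]
* J. Milnor, *Lectures on the h-cobordism theorem* (1965), Def. 3.1, Thm. 3.4. [MilnorHCobordism1965]
-/

open scoped Manifold ContDiff Topology
open Set Function Filter

noncomputable section

universe u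

namespace Literature.Topology.FourManifolds

open Flow

/-- Local notation: `𝔼 n` is the model Euclidean space `EuclideanSpace ℝ (Fin n)`. -/
local notation "𝔼 " n:arg => EuclideanSpace ℝ (Fin n)

/-! ### Sign of the derivative and one-sided comparison -/

/-- A function with positive derivative at `0` is smaller just before `0` and larger just after. [folklore] -/
theorem eventually_lt_and_gt_of_hasDerivAt_pos {g : ℝ → ℝ} {g' : ℝ} (hg : HasDerivAt g g' 0) (hpos : 0 < g') :
    (∀ᶠ t in 𝓝[<] (0 : ℝ), g t < g 0) ∧ ∀ᶠ t in 𝓝[>] (0 : ℝ), g 0 < g t := by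
  obtain ⟨hl, hr⟩ := hasDerivAt_iff_tendsto_slope_left_right.1 hg
  have hl' : ∀ᶠ t in 𝓝[<] (0 : ℝ), 0 < slope g 0 t := hl.eventually (Ioi_mem_nhds hpos)
  have hr' : ∀ᶠ t in 𝓝[>] (0 : ℝ), 0 < slope g 0 t := hr.eventually (Ioi_mem_nhds hpos)
  constructor
  · filter_upwards [hl', self_mem_nhdsWithin] with t ht hlt
    have hlt' : t < 0 := hlt
    rw [slope_def_field, sub_zero] at ht
    rcases div_pos_iff.1 ht with ⟨_, h2⟩ | ⟨h1, _⟩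
    · linarith
    · linarith
  · filter_upwards [hr', self_mem_nhdsWithin] with t ht hgt
    have hgt' : 0 < t := hgt
    rw [slope_def_field, sub_zero] at ht
    rcases div_pos_iff.1 ht with ⟨h1, _⟩ | ⟨_, h2⟩
    · linarith
    · linarith

/-- A function with negative derivative at `0` is larger just before `0` and smaller just after. [folklore] -/
theorem eventually_gt_and_lt_of_hasDerivAt_neg {g : ℝ → ℝ} {g' : ℝ} (hg : HasDerivAt g g' 0) (hneg : g' < 0) :
    (∀ᶠ t in 𝓝[<] (0 : ℝ), g 0 < g t) ∧ ∀ᶠ t in 𝓝[>] (0 : ℝ), g t < g 0 := by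
  have hg' : HasDerivAt (fun t => -g t) (-g') 0 := hg.neg
  obtain ⟨h1, h2⟩ := eventually_lt_and_gt_of_hasDerivAt_pos hg' (by linarith)
  exact ⟨h1.mono fun t ht => by linarith, h2.mono fun t ht => by linarith⟩

/-! ### Preconnectedness from a core met by every clopen piece -/

variable {X : Type u} [TopologicalSpace X]

/-- **A set is preconnected if every piece of a clopen decomposition meets a preconnected core.** [folklore] -/
theorem isPreconnected_of_core {S C : Set X} (hCS : C ⊆ S) (hC : IsPreconnected C)
    (h : ∀ u v : Set X, IsOpen u → IsOpen v → S ⊆ u ∪ v → S ∩ (u ∩ v) = ∅ → (S ∩ u).Nonempty → (C ∩ u).Nonempty) :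
    IsPreconnected S := by
  intro u v hu hv hSuv hSu hSv
  by_contra hemp
  have he : S ∩ (u ∩ v) = ∅ := not_nonempty_iff_eq_empty.1 hemp
  obtain ⟨c₁, hc₁C, hc₁u⟩ := h u v hu hv hSuv he hSu
  obtain ⟨c₂, hc₂C, hc₂v⟩ := h v u hv hu (by rwa [union_comm]) (by rwa [inter_comm v u]) hSv
  obtain ⟨z, hzC, hzuv⟩ := hC u v hu hv (hCS.trans hSuv) ⟨c₁, hc₁C, hc₁u⟩ ⟨c₂, hc₂C, hc₂v⟩
  exact hemp ⟨z, hCS hzC, hzuv⟩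

variable [T2Space X] [CompactSpace X] [ChartedSpace (𝔼 4) X] [IsManifold (𝓡 4) ∞ X]

omit [T2Space X] [ChartedSpace (𝔼 4) X] [IsManifold (𝓡 4) ∞ X] in
/-- A piece `S ∩ u` of a clopen decomposition of a closed set is compact. [folklore] -/
theorem isCompact_piece {S u v : Set X} (hS : IsClosed S) (hv : IsOpen v) (hSuv : S ⊆ u ∪ v)
    (he : S ∩ (u ∩ v) = ∅) : IsCompact (S ∩ u) ∧ S ∩ u = S ∩ vᶜ := by
  have heq : S ∩ u = S ∩ vᶜ := by
    ext x
    constructor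
    · rintro ⟨hxS, hxu⟩
      exact ⟨hxS, fun hxv => by have : x ∈ S ∩ (u ∩ v) := ⟨hxS, hxu, hxv⟩; rw [he] at this; exact this⟩
    · rintro ⟨hxS, hxv⟩
      rcases hSuv hxS with h | h
      · exact ⟨hxS, h⟩
      · exact absurd h hxv
  rw [heq]
  exact ⟨(hS.inter hv.isClosed_compl).isCompact, rfl⟩

variable (B : BiCollar X) {η : ℝ} {ι : Type} [Fintype ι] {ζ : Π x : X, TangentSpace (𝓡 4) x}
  (H : HandleBoxes B.f ζ B.a η ι) {hζ : ContMDiff (𝓡 4) (𝓡 4).tangent ∞ fun x => (⟨x, ζ x⟩ : TangentBundle (𝓡 4) X)}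
  {h₂ TP χlo χhi : ℝ → ℝ} {Spl Sbot Smin Psw : ℝ} (D : B.TwoFnData)

namespace BiCollar.TwoFnData

/-- **Derivatives along the flow of `f` and `T` at a band point.** [cite: MilnorHCobordism1965, Def. 3.1] -/
theorem hasDerivAt_f_T_flow (hgl : IsGradientLike (𝓡 4) B.f ζ) (hfM : IsMorse (𝓡 4) B.f)
    (hDT : D.T = H.topHeightBot hζ B.hf B.g h₂ TP χlo χhi Spl Sbot Smin Psw)
    (hT : ContMDiff (𝓡 4) 𝓘(ℝ, ℝ) ∞ (H.topHeight hζ B.hf B.g h₂ TP χlo χhi Spl Smin Psw))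
    (hχlo : ContDiff ℝ ∞ χlo) (hχhi : ContDiff ℝ ∞ χhi)
    {P₁ v₁ : ℝ} (hPsw0 : 0 < Psw) (hPsw : 2 * Psw ≤ η ^ 2) (hP₁ : 2 * P₁ < Psw)
    (hTP₂ : ∀ P, 2 * P₁ ≤ P → TP P = Spl) (hh₂v : ∀ t ≤ v₁, h₂ t = Spl)
    (hφv : ∀ j (y : RegularLevel B.hf), y.1 ∈ (H.box j).chart.source → H.P j y.1 < 2 * Psw → B.g y ≤ v₁)
    {p : X} (hf₁ : B.a - η < B.f p) (hf₂ : B.f p < B.a + 2 * η) :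
    HasDerivAt (fun t => B.f (flow hζ p t)) (mlineDeriv (𝓡 4) B.f p (ζ p)) 0 ∧
      HasDerivAt (fun t => D.T (flow hζ p t))
        (H.topCoeffBot hζ B.hf B.g h₂ TP χlo χhi Spl Sbot Smin Psw p * mlineDeriv (𝓡 4) B.f p (ζ p)) 0 := by
  have hfd : MDifferentiable (𝓡 4) 𝓘(ℝ, ℝ) B.f := hfM.contMDiff.mdifferentiable (by simp)
  have hTd : MDifferentiable (𝓡 4) 𝓘(ℝ, ℝ) D.T := by
    rw [hDT]; exact (H.contMDiff_topHeightBot hfM hχlo hT).mdifferentiable (by simp)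
  have h1 := hasDerivAt_comp_flow hζ hfd p 0
  have h2 := hasDerivAt_comp_flow hζ hTd p 0
  have heq : mlineDeriv (𝓡 4) D.T p (ζ p) =
      H.topCoeffBot hζ B.hf B.g h₂ TP χlo χhi Spl Sbot Smin Psw p * mlineDeriv (𝓡 4) B.f p (ζ p) := by
    rw [hDT]; exact H.mlineDeriv_topHeightBot_eq hgl hfM hT hχlo hχhi hPsw0 hPsw hP₁ hTP₂ hh₂v hφv hf₁ hf₂
  refine ⟨h1.congr_deriv (by rw [flow_zero]), h2.congr_deriv (by rw [flow_zero, heq])⟩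

/-- The flow of a point stays in an open set and keeps strict inequalities for short times. [folklore] -/
theorem eventually_flow_mem {p : X} {u : Set X} (hu : IsOpen u) (hp : p ∈ u) :
    ∀ᶠ t in 𝓝 (0 : ℝ), flow hζ p t ∈ u := by
  have hc : Continuous (flow hζ p) := continuous_flow hζ p
  have := hc.continuousAt (x := (0 : ℝ))
  rw [ContinuousAt, flow_zero] at this
  exact this (hu.mem_nhds hp)

/-- **The second sector is preconnected** when its level part lies in a preconnected core and
the critical points of the band are not local minima of `f`. [cite: GayKirby2016, §4, Lemma 14] -/
theorem isPreconnected_S₂ (hgl : IsGradientLike (𝓡 4) B.f ζ) (hfM : IsMorse (𝓡 4) B.f)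
    (hDT : D.T = H.topHeightBot hζ B.hf B.g h₂ TP χlo χhi Spl Sbot Smin Psw)
    (hT : ContMDiff (𝓡 4) 𝓘(ℝ, ℝ) ∞ (H.topHeight hζ B.hf B.g h₂ TP χlo χhi Spl Smin Psw))
    (hχlo : ContDiff ℝ ∞ χlo) (hχhi : ContDiff ℝ ∞ χhi)
    {P₁ v₁ : ℝ} (hPsw0 : 0 < Psw) (hPsw : 2 * Psw ≤ η ^ 2) (hP₁ : 2 * P₁ < Psw)
    (hTP₂ : ∀ P, 2 * P₁ ≤ P → TP P = Spl) (hh₂v : ∀ t ≤ v₁, h₂ t = Spl)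
    (hφv : ∀ j (y : RegularLevel B.hf), y.1 ∈ (H.box j).chart.source → H.P j y.1 < 2 * Psw → B.g y ≤ v₁)
    (hTle : ∀ z, D.T z ≤ Sbot) (hSbot : Sbot < 2 * η)
    (hD : ∀ z, B.a - η < B.f z → B.f z < B.a + 2 * η →
      H.topCoeffBot hζ B.hf B.g h₂ TP χlo χhi Spl Sbot Smin Psw z ≤ 0)
    (hcpt_T : ∀ j, B.f (H.cpt j) - B.a < D.T (H.cpt j)) (hcpt_min : ∀ j, ¬ IsLocalMin B.f (H.cpt j))
    {C : Set X} (hCS : C ⊆ D.S₂) (hC : IsPreconnected C) (hYC : ∀ p ∈ D.S₂, B.f p = B.a → p ∈ C) :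
    IsPreconnected D.S₂ := by
  have hη := H.eta_pos
  have hcontf : Continuous B.f := hfM.contMDiff.continuous
  have hband : ∀ z ∈ D.S₂, B.a - η < B.f z ∧ B.f z < B.a + 2 * η := by
    intro z hz; have := hTle z; have := hz.1; have := hz.2; exact ⟨by linarith, by linarith⟩
  refine isPreconnected_of_core hCS hC fun u v hu hv hSuv he hne => ?_
  obtain ⟨hK, hKeq⟩ := isCompact_piece D.isClosed_S₂ hv hSuv he
  obtain ⟨p, ⟨hpS, hpu⟩, hpmin⟩ := hK.exists_isMinOn hne hcontf.continuousOn
  refine ⟨p, hYC p hpS ?_, hpu⟩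
  -- the minimiser lies on the level
  by_contra hpa
  have hs : 0 < B.f p - B.a := lt_of_le_of_ne hpS.1 (fun h => hpa (by linarith))
  obtain ⟨hf₁, hf₂⟩ := hband p hpS
  rcases hpS.2.lt_or_eq with hsT | hsT
  · -- interior: a local minimum of `f` on `X`, hence a critical point of the band: impossible
    have hmin : IsLocalMin B.f p := by
      have hopen : IsOpen ({x | 0 < B.f x - B.a ∧ B.f x - B.a < D.T x} ∩ u) :=
        ((isOpen_lt continuous_const (hcontf.sub continuous_const)).inter
          (isOpen_lt (hcontf.sub continuous_const) D.continuous_T)).inter hu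
      have hmem : ({x | 0 < B.f x - B.a ∧ B.f x - B.a < D.T x} ∩ u) ∈ 𝓝 p := hopen.mem_nhds ⟨⟨hs, hsT⟩, hpu⟩
      filter_upwards [hmem] with y hy
      exact hpmin ⟨⟨hy.1.1.le, hy.1.2.le⟩, hy.2⟩
    have hc : IsMCriticalPt (𝓡 4) B.f p := IsLocalMin.isMCriticalPt (I := 𝓡 4) hmin
    obtain ⟨j, rfl⟩ := H.crit_val p hc hf₁.le hf₂
    exact hcpt_min j hmin
  · -- top face: flow backwards into the piece, decreasing `f`
    have hreg : ¬ IsMCriticalPt (𝓡 4) B.f p := by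
      intro hc
      obtain ⟨j, rfl⟩ := H.crit_val p hc hf₁.le hf₂
      have := hcpt_T j; linarith
    obtain ⟨hdf, hdT⟩ := D.hasDerivAt_f_T_flow B H hgl hfM hDT hT hχlo hχhi hPsw0 hPsw hP₁ hTP₂ hh₂v hφv hf₁ hf₂
    have hξf := hgl.mlineDeriv_pos p hreg
    have hDp := hD p hf₁ hf₂
    -- `f` decreases backwards
    obtain ⟨hf_lt, -⟩ := eventually_lt_and_gt_of_hasDerivAt_pos hdf hξf
    -- `T - s` increases backwards
    have hdg : HasDerivAt (fun t => D.T (flow hζ p t) - B.f (flow hζ p t))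
        ((H.topCoeffBot hζ B.hf B.g h₂ TP χlo χhi Spl Sbot Smin Psw p - 1) * mlineDeriv (𝓡 4) B.f p (ζ p)) 0 :=
      (hdT.sub hdf).congr_deriv (by ring)
    obtain ⟨hg_gt, -⟩ := eventually_gt_and_lt_of_hasDerivAt_neg hdg (mul_neg_of_neg_of_pos (by linarith) hξf)
    have hu_mem : ∀ᶠ t in 𝓝[<] (0 : ℝ), flow hζ p t ∈ u := nhdsWithin_le_nhds (eventually_flow_mem (hζ := hζ) hu hpu)
    have hs_pos : ∀ᶠ t in 𝓝[<] (0 : ℝ), 0 < B.f (flow hζ p t) - B.a := by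
      have hopen : IsOpen {x | 0 < B.f x - B.a} := isOpen_lt continuous_const (hcontf.sub continuous_const)
      exact nhdsWithin_le_nhds ((eventually_flow_mem (hζ := hζ) hopen hs).mono fun t ht => ht)
    obtain ⟨t, ⟨⟨hft, hgt⟩, hut⟩, hst⟩ := (((hf_lt.and hg_gt).and hu_mem).and hs_pos).exists
    simp only [flow_zero] at hft hgt
    have hmemS : flow hζ p t ∈ D.S₂ := ⟨hst.le, by linarith⟩
    have := hpmin ⟨hmemS, hut⟩
    exact absurd this (not_le.2 hft)

/-- **The first sector is preconnected** when every local minimum of `f` below the level is the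
point `m₀ ∈ X₁`. [cite: GayKirby2016, §4, Lemma 14] -/
theorem isPreconnected_S₁ (hgl : IsGradientLike (𝓡 4) B.f ζ) (hfM : IsMorse (𝓡 4) B.f)
    (hDT : D.T = H.topHeightBot hζ B.hf B.g h₂ TP χlo χhi Spl Sbot Smin Psw)
    (hT : ContMDiff (𝓡 4) 𝓘(ℝ, ℝ) ∞ (H.topHeight hζ B.hf B.g h₂ TP χlo χhi Spl Smin Psw))
    (hχlo : ContDiff ℝ ∞ χlo) (hχhi : ContDiff ℝ ∞ χhi)
    {P₁ v₁ : ℝ} (hPsw0 : 0 < Psw) (hPsw : 2 * Psw ≤ η ^ 2) (hP₁ : 2 * P₁ < Psw)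
    (hTP₂ : ∀ P, 2 * P₁ ≤ P → TP P = Spl) (hh₂v : ∀ t ≤ v₁, h₂ t = Spl)
    (hφv : ∀ j (y : RegularLevel B.hf), y.1 ∈ (H.box j).chart.source → H.P j y.1 < 2 * Psw → B.g y ≤ v₁)
    (hTge : ∀ z, -Smin ≤ D.T z) (hSmin : Smin < 2 * η)
    (hD : ∀ z, B.a - η < B.f z → B.f z ≤ B.a →
      H.topCoeffBot hζ B.hf B.g h₂ TP χlo χhi Spl Sbot Smin Psw z ≤ 0)
    {m₀ : X} (hm₀ : m₀ ∈ D.S₁) (hmin : ∀ p, IsLocalMin B.f p → B.f p < B.a → p = m₀) :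
    IsPreconnected D.S₁ := by
  have hη := H.eta_pos
  have hcontf : Continuous B.f := hfM.contMDiff.continuous
  refine isPreconnected_of_core (singleton_subset_iff.2 hm₀) isPreconnected_singleton fun u v hu hv hSuv he hne => ?_
  obtain ⟨hK, hKeq⟩ := isCompact_piece D.isClosed_S₁ hv hSuv he
  obtain ⟨p, ⟨hpS, hpu⟩, hpmin⟩ := hK.exists_isMinOn hne hcontf.continuousOn
  by_cases hint : B.f p - B.a < 0 ∧ 2 * (B.f p - B.a) < D.T p
  · -- interior minimiser: the minimum `m₀`
    have hlm : IsLocalMin B.f p := by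
      have hopen : IsOpen ({x | B.f x - B.a < 0 ∧ 2 * (B.f x - B.a) < D.T x} ∩ u) :=
        ((isOpen_lt (hcontf.sub continuous_const) continuous_const).inter
          (isOpen_lt (continuous_const.mul (hcontf.sub continuous_const)) D.continuous_T)).inter hu
      filter_upwards [hopen.mem_nhds ⟨hint, hpu⟩] with y hy
      exact hpmin ⟨⟨hy.1.1.le, hy.1.2.le⟩, hy.2⟩
    have hp0 := hmin p hlm (by linarith [hint.1])
    subst hp0
    exact ⟨p, rfl, hpu⟩
  · -- face minimiser: flow backwards into the piece, decreasing `f`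
    exfalso
    have hface : B.f p - B.a = 0 ∨ D.T p = 2 * (B.f p - B.a) := by
      rcases hpS.1.lt_or_eq with h1 | h1
      · right; by_contra h2; exact hint ⟨h1, lt_of_le_of_ne hpS.2 (Ne.symm h2)⟩
      · exact Or.inl h1
    have hf₁ : B.a - η < B.f p := by
      rcases hface with h0 | h0
      · linarith
      · have := hTge p; linarith
    have hf₂ : B.f p ≤ B.a := by linarith [hpS.1]
    have hreg : ¬ IsMCriticalPt (𝓡 4) B.f p := by
      intro hc
      obtain ⟨j, rfl⟩ := H.crit_val p hc hf₁.le (by linarith)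
      have := H.apply_cpt j; linarith
    obtain ⟨hdf, hdT⟩ := D.hasDerivAt_f_T_flow B H hgl hfM hDT hT hχlo hχhi hPsw0 hPsw hP₁ hTP₂ hh₂v hφv hf₁ (by linarith)
    have hξf := hgl.mlineDeriv_pos p hreg
    have hDp := hD p hf₁ hf₂
    obtain ⟨hf_lt, -⟩ := eventually_lt_and_gt_of_hasDerivAt_pos hdf hξf
    -- `2s - T` decreases backwards
    have hdg : HasDerivAt (fun t => 2 * (B.f (flow hζ p t) - B.a) - D.T (flow hζ p t))
        ((2 - H.topCoeffBot hζ B.hf B.g h₂ TP χlo χhi Spl Sbot Smin Psw p) * mlineDeriv (𝓡 4) B.f p (ζ p)) 0 :=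
      (((hdf.sub_const B.a).const_mul 2).sub hdT).congr_deriv (by ring)
    obtain ⟨hg_lt, -⟩ := eventually_lt_and_gt_of_hasDerivAt_pos hdg (mul_pos (by linarith) hξf)
    have hu_mem : ∀ᶠ t in 𝓝[<] (0 : ℝ), flow hζ p t ∈ u := nhdsWithin_le_nhds (eventually_flow_mem (hζ := hζ) hu hpu)
    obtain ⟨t, ⟨hft, hgt⟩, hut⟩ := ((hf_lt.and hg_lt).and hu_mem).exists
    simp only [flow_zero] at hft hgt
    have h2sT : 2 * (B.f p - B.a) - D.T p ≤ 0 := by linarith [hpS.2]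
    have hmemS : flow hζ p t ∈ D.S₁ := ⟨by show B.f _ - B.a ≤ 0; linarith, by
      show 2 * (B.f _ - B.a) ≤ D.T _; linarith⟩
    have := hpmin ⟨hmemS, hut⟩
    exact absurd this (not_le.2 hft)

/-- **The third sector is preconnected** when every local maximum of `f` is the point
`M₀ ∈ X₃`, the top height is the constant `-S_min < 0` above the band, and the critical points
of the band do not lie on the faces. [cite: GayKirby2016, §4, Lemma 14] -/
theorem isPreconnected_S₃ (hgl : IsGradientLike (𝓡 4) B.f ζ) (hfM : IsMorse (𝓡 4) B.f)
    (hDT : D.T = H.topHeightBot hζ B.hf B.g h₂ TP χlo χhi Spl Sbot Smin Psw)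
    (hT : ContMDiff (𝓡 4) 𝓘(ℝ, ℝ) ∞ (H.topHeight hζ B.hf B.g h₂ TP χlo χhi Spl Smin Psw))
    (hχlo : ContDiff ℝ ∞ χlo) (hχhi : ContDiff ℝ ∞ χhi)
    {P₁ v₁ : ℝ} (hPsw0 : 0 < Psw) (hPsw : 2 * Psw ≤ η ^ 2) (hP₁ : 2 * P₁ < Psw)
    (hTP₂ : ∀ P, 2 * P₁ ≤ P → TP P = Spl) (hh₂v : ∀ t ≤ v₁, h₂ t = Spl)
    (hφv : ∀ j (y : RegularLevel B.hf), y.1 ∈ (H.box j).chart.source → H.P j y.1 < 2 * Psw → B.g y ≤ v₁)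
    (hTge : ∀ z, -Smin ≤ D.T z) (hSmin : Smin < 2 * η) (hSmin0 : 0 < Smin)
    (hT_above : ∀ z, B.a + 2 * η ≤ B.f z → D.T z = -Smin)
    (hD : ∀ z, B.a - η < B.f z → B.f z < B.a + 2 * η →
      H.topCoeffBot hζ B.hf B.g h₂ TP χlo χhi Spl Sbot Smin Psw z ≤ 0)
    (hcpt_face : ∀ j, D.T (H.cpt j) ≠ B.f (H.cpt j) - B.a ∧ D.T (H.cpt j) ≠ 2 * (B.f (H.cpt j) - B.a))
    {M₀ : X} (hM₀ : M₀ ∈ D.S₃) (hmax : ∀ p, IsLocalMax B.f p → p = M₀) :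
    IsPreconnected D.S₃ := by
  have hη := H.eta_pos
  have hcontf : Continuous B.f := hfM.contMDiff.continuous
  refine isPreconnected_of_core (singleton_subset_iff.2 hM₀) isPreconnected_singleton fun u v hu hv hSuv he hne => ?_
  obtain ⟨hK, hKeq⟩ := isCompact_piece D.isClosed_S₃ hv hSuv he
  obtain ⟨p, ⟨hpS, hpu⟩, hpmax⟩ := hK.exists_isMaxOn hne hcontf.continuousOn
  by_cases hint : D.T p < 2 * (B.f p - B.a) ∧ D.T p < B.f p - B.a
  · have hlm : IsLocalMax B.f p := by
      have hopen : IsOpen ({x | D.T x < 2 * (B.f x - B.a) ∧ D.T x < B.f x - B.a} ∩ u) :=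
        ((isOpen_lt D.continuous_T (continuous_const.mul (hcontf.sub continuous_const))).inter
          (isOpen_lt D.continuous_T (hcontf.sub continuous_const))).inter hu
      filter_upwards [hopen.mem_nhds ⟨hint, hpu⟩] with y hy
      exact hpmax ⟨⟨hy.1.1.le, hy.1.2.le⟩, hy.2⟩
    have hp0 := hmax p hlm
    subst hp0
    exact ⟨p, rfl, hpu⟩
  · exfalso
    have hface : D.T p = B.f p - B.a ∨ D.T p = 2 * (B.f p - B.a) := by
      rcases hpS.2.lt_or_eq with h1 | h1
      · right; by_contra h2; exact hint ⟨lt_of_le_of_ne hpS.1 h2, h1⟩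
      · exact Or.inl h1
    have hf₂ : B.f p < B.a + 2 * η := by
      by_contra hge; push Not at hge
      have hT' := hT_above p hge
      rcases hface with h0 | h0 <;> linarith
    have hf₁ : B.a - η < B.f p := by have := hTge p; have := hpS.1; linarith
    have hreg : ¬ IsMCriticalPt (𝓡 4) B.f p := by
      intro hc
      obtain ⟨j, rfl⟩ := H.crit_val p hc hf₁.le hf₂
      rcases hface with h0 | h0
      · exact (hcpt_face j).1 h0
      · exact (hcpt_face j).2 h0
    obtain ⟨hdf, hdT⟩ := D.hasDerivAt_f_T_flow B H hgl hfM hDT hT hχlo hχhi hPsw0 hPsw hP₁ hTP₂ hh₂v hφv hf₁ hf₂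
    have hξf := hgl.mlineDeriv_pos p hreg
    have hDp := hD p hf₁ hf₂
    obtain ⟨-, hf_gt⟩ := eventually_lt_and_gt_of_hasDerivAt_pos hdf hξf
    -- `T - s` and `T - 2s` decrease forwards
    have hdg₁ : HasDerivAt (fun t => D.T (flow hζ p t) - (B.f (flow hζ p t) - B.a))
        ((H.topCoeffBot hζ B.hf B.g h₂ TP χlo χhi Spl Sbot Smin Psw p - 1) * mlineDeriv (𝓡 4) B.f p (ζ p)) 0 :=
      (hdT.sub (hdf.sub_const B.a)).congr_deriv (by ring)
    have hdg₂ : HasDerivAt (fun t => D.T (flow hζ p t) - 2 * (B.f (flow hζ p t) - B.a))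
        ((H.topCoeffBot hζ B.hf B.g h₂ TP χlo χhi Spl Sbot Smin Psw p - 2) * mlineDeriv (𝓡 4) B.f p (ζ p)) 0 :=
      (hdT.sub ((hdf.sub_const B.a).const_mul 2)).congr_deriv (by ring)
    obtain ⟨-, hg₁⟩ := eventually_gt_and_lt_of_hasDerivAt_neg hdg₁ (mul_neg_of_neg_of_pos (by linarith) hξf)
    obtain ⟨-, hg₂⟩ := eventually_gt_and_lt_of_hasDerivAt_neg hdg₂ (mul_neg_of_neg_of_pos (by linarith) hξf)
    have hu_mem : ∀ᶠ t in 𝓝[>] (0 : ℝ), flow hζ p t ∈ u := nhdsWithin_le_nhds (eventually_flow_mem (hζ := hζ) hu hpu)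
    obtain ⟨t, ⟨⟨hft, hg₁t⟩, hg₂t⟩, hut⟩ := (((hf_gt.and hg₁).and hg₂).and hu_mem).exists
    simp only [flow_zero] at hft hg₁t hg₂t
    have h1 : D.T p - (B.f p - B.a) ≤ 0 := by linarith [hpS.2]
    have h2 : D.T p - 2 * (B.f p - B.a) ≤ 0 := by linarith [hpS.1]
    have hmemS : flow hζ p t ∈ D.S₃ := ⟨by show D.T _ ≤ 2 * (B.f _ - B.a); linarith, by
      show D.T _ ≤ B.f _ - B.a; linarith⟩
    have := hpmax ⟨hmemS, hut⟩
    exact absurd this (not_le.2 hft)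

end BiCollar.TwoFnData

end Literature.Topology.FourManifolds

end
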